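import Literature.NumberTheory.Automorphic.CuspidalContragredientProofs
import HarnessLib

/-!
# Sketch2 — the CYCLE-FREE structural proof module a prover would land for the crux
`ContragredientDatum` (item stmt-Langlands-14322, route `IrreducibilityBySelfDuality`).

This file deliberately does NOT import the Theses file (kill criterion (e) of the route: the gate
links `ContragredientDatum_holds := _root_.<thm>` by importing the proving module INTO the Theses
file, so the proving module must not import it).  The theorem text is the route decl VERBATIM; it is
definitionally the route decl (checked in Sketch.lean, which imports both).
Intended tree path: `Summits/Langlands/Langlands/Theorems/IrreducibilityBySelfDualityContragredientDatum.lean`.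
-/

noncomputable section

set_option linter.dupNamespace false

namespace Summit.Langlands.Langlands.Theorems.ContragredientDatum

open Filter

/-- `ContragredientDatum` (route `IrreducibilityBySelfDuality`, item stmt-Langlands-14322), text
verbatim: every cuspidal Borel–Jacquet datum on `GL_n(𝔸_K)` has a cuspidal contragredient datum with
inverse Satake parameters at every place where it has Satake parameters.  Proof: the landed discharge
`CuspidalAutomorphicRepData.exists_contragredient_satake_holds` (CuspidalContragredientProofs:
`π' = (W ∘ τ)/(W' ∘ τ)`, `τ g = w₀ ᵗg⁻¹ w₀`). -/
theorem ContragredientDatum_proof :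
    ∀ (n : ℕ) (K : Type) [Field K] [NumberField K] (hcpt : Literature.NumberTheory.Automorphic.isCompact_glFiniteIntegralLevel n K) (π : Literature.NumberTheory.Automorphic.CuspidalAutomorphicRepData n K hcpt), ∃ π' : Literature.NumberTheory.Automorphic.CuspidalAutomorphicRepData n K hcpt, ∀ (v : IsDedekindDomain.HeightOneSpectrum (NumberField.RingOfIntegers K)) (α : Multiset ℂ), π.1.HasSatakeParamAt v α → π'.1.HasSatakeParamAt v (α.map (·⁻¹)) :=
  fun _ _ _ _ hcpt => Literature.NumberTheory.Automorphic.CuspidalAutomorphicRepData.exists_contragredient_satake_holds hcpt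

#print axioms ContragredientDatum_proof

end Summit.Langlands.Langlands.Theorems.ContragredientDatum
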